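import Summits.CriticalPhenomena.PercolationContinuityZ3.Theorems.Transplant.SkelPhiRouteDatumHab
import HarnessLib

/-!
# D″ node, LEVEL 1 (c′) closed up: the TWO-SCALE KIT CLAUSE OF A HABITAT WINDOW LEVEL FROM THE STEP-I′ CERTIFICATE — `Skelφ.kitClauseHab'`
# (chain explored in `winGraphIn G Ω`) with its per-contact hypothesis `hcon'` DISCHARGED by `Skelφ.kitCon_stepIHab` and its zone-family room by
# `Skelφ.fatSeqOff_kit_room`: ONE call per level `j` of a corridor-chain step (`SkelPhiWinChainS.kitsAt_stepA`'s `hkits` at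
# `G' = winGraphIn G Ω`, `𝒲 = planarWindowIn hlip Ω`)

builds on p205010 (kernel theorem, internal audit signed; external expert review pending) — nothing in this file uses p205010.
Lane `prim-bschramm`, seat `prim-bschramm-p1` (gen 9); helper file (`--supports stmt-CriticalPhenomena-4575 --as helper`).
* **`kitClauseHab_stepI`**.
[cite: KozmaNitzan2024, §4 Lemma 10, Steps III–V (pp. 19–22), Lemma 11 (pp. 22–23)]
-/

noncomputable section

open scoped Classical

namespace Summit.CriticalPhenomena.PercolationContinuityZ3.Theorems.Transplant

namespace Skelφ

open MeasureTheory
open Literature.Probability.Percolation Literature.Probability.LatticeModels SimpleGraph KNLevels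
open Literature.Barriers.CriticalPhenomena (graphBall graphBall_finite mem_graphBall_self graphBall_mono)
open Skel (winGraph winGraph_adj winGraph_le KitGeom winGraphIn winGraphIn_adj winGraphIn_le)
open SkelI (tanOff)
open Literature.Probability.Percolation.KozmaNitzan.Cells (oth oth_ne eq_oth_of_ne oth_oth)

variable {V : Type} [DecidableEq V] {G : SimpleGraph V} [G.LocallyFinite] {φ : V → Site 2} {types : Finset V}
  {w₀ : V} {R : ℕ} {lo hi : Site 2} {j ℓs M K : ℕ} {A : Fin 2 → Fin 2 → ℕ} {Rk : Fin 2 → ℕ}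

/-- **THE TWO-SCALE KIT CLAUSE OF THE HABITAT WINDOW LEVEL `j` FROM THE STEP-I′ CERTIFICATE** (habitat `Ω ⊇` the plain level). Dictionary hypotheses, the degree bound, the Step-I′
certificate at the running density `q` with threshold `1 − δ²` (data `D` over `fatSeqOff off`), the kit (zone scale `Mz ∈ Sz` above the seed
level `D.k`, certified extents `ℓK`, half-widths `A I = widths (ℓK I)`, radii `Rk I = D.R (amax (A I))`) with the slab/shell rooms of
`kitClause'` (`n := Mz`, `ρ := ψ Mz + off`), the route along `ax` (certified extents `[ℓ₀, ℓ₁]` beyond `Mz`, depth, band spread `Wr`, the planar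
room at every point of the level box with region `Preg` / core `Pcore`), the plain windows over the room inside `Ω`, the region `D` / the target
`T`, far and non-plain inner neighbours inside `T`, the subbox weighting `Wt` of the habitat graph on `D ⊇` the habitat level, the count `N` and
the kit number `k` ⟹ the kit clause of the habitat level `j` towards `T` inside `D` (the `hkits` of `Skelφ.WinChainData.kitsAt_stepA` at
`G' = winGraphIn G Ω`).
[cite: KozmaNitzan2024, §4 Lemma 10, Steps III–V (pp. 19–22), Lemma 11 (pp. 22–23)] -/
theorem kitClauseHab_stepI [Countable V] (hlip : Lip G φ) (hstep : Steps G φ) (hfr : Frames G φ types) (hκ : CylConn G φ types) {Δ : ℕ}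
    (hΔ : ∀ v, G.degree v ≤ Δ) {p : unitInterval} (hC : CylSubcritical G φ types p) {D : StepI.Data V} {off : ℕ}
    (hD : D.Λ = fatSeqOff hfr hC off) {Sz Sx Sy : Finset ℕ} {q : unitInterval} {δ : ℝ} (hδ : 0 < δ)
    (h : ∀ i ∈ StepI.index types Sz Sx Sy, 1 - δ ^ 2 < (bondPercolation G q).real (StepI.event G φ D i))
    -- the kit: zone scale, certified extents, half-widths, radii
    {Mz : ℕ} (hMz : Mz ∈ Sz) (hkz : D.k ≤ Mz) {ℓK : Fin 2 → ℕ} (hℓK0 : ∀ I, I = 0 → ℓK I ∈ Sx) (hℓK1 : ∀ I, I = 1 → ℓK I ∈ Sy)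
    (hAw : ∀ I, A I = StepI.widths D.Gb D.Fb I (ℓK I)) (hRk : ∀ I, Rk I = D.R (amax (A I)))
    -- the slab and shell rooms of `kitClause'`
    {R' r₀ rs : ℕ} (hℓs : 1 ≤ ℓs) (hwide : ∀ i, (lo - (j : Site 2)) i + 2 * tanOff ℓs M ≤ (hi + (j : Site 2)) i)
    (hA : ∀ i k, A i k ≤ M) (hAℓ : ∀ i, A i (oth i) ≤ ℓs) (hK : ∀ i, ℓs + 1 + A i i + Rk i ≤ K)
    (hnA : ∀ i, Mz + 1 ≤ A i i) (hnM : Mz ≤ M) (hρK : ∀ i, ℓs + 1 + A i i + (fatRadius hfr hC Mz + off) ≤ K)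
    (hR'₁ : cylRadMax G φ types ℓs (ℓs + 2 + 2 * tanOff ℓs M) ≤ R') (hR'₂ : ∀ i, cylRadMax G φ types ℓs (ℓs + 2 + A i i + Rk i) ≤ R')
    (hr₀₁ : ℓs + 1 + tanOff ℓs M + R' ≤ r₀) (hr₀₂ : ℓs + 2 + tanOff ℓs M + K ≤ r₀) (hR : r₀ ≤ R)
    (hrs₁ : ℓs + 2 + tanOff ℓs M + R' ≤ rs) (hrs₂ : ℓs + 2 + tanOff ℓs M + K ≤ rs) {cU : ℕ} (hcU : ∀ i, (Δ + 1) ^ Rk i ≤ cU)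
    -- the route: axis, certified extents beyond the zone scale, depth, band spread
    (ax : Fin 2) {ℓ₀ ℓ₁ : ℕ} (hMℓ : Mz + 1 ≤ ℓ₀)
    (hS0 : ax = 0 → ∀ ℓ, ℓ₀ ≤ ℓ → ℓ ≤ ℓ₁ → ℓ ∈ Sx) (hS1 : ax = 1 → ∀ ℓ, ℓ₀ ≤ ℓ → ℓ ≤ ℓ₁ → ℓ ∈ Sy)
    (hdepth : ∀ I ℓ, ℓ₀ ≤ ℓ → ℓ ≤ ℓ₁ → 2 * ℓs + 2 + tanOff ℓs M + A I I + D.R (amax (StepI.widths D.Gb D.Fb ax ℓ)) ≤ r₀)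
    {Wr : ℕ → ℕ} (hWr : ∀ ℓ, ℓ₀ ≤ ℓ → ℓ ≤ ℓ₁ → StepI.widths D.Gb D.Fb ax ℓ (oth ax) ≤ Wr ℓ)
    -- the planar room at every point of the level box
    {Preg Pcore : Finset (Site 2)}
    (hroom : ∀ v ∈ Finset.Icc (lo - (j : Site 2)) (hi + (j : Site 2)), ∃ ℓ : ℕ, ℓ₀ ≤ ℓ ∧ ℓ ≤ ℓ₁ ∧
      ∃ σ : ℤ, (σ = 1 ∨ σ = -1) ∧
        (∀ y : Site 2, |y ax - v ax| ≤ ℓ → |y (oth ax) - v (oth ax)| ≤ Wr ℓ → y ∈ Preg) ∧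
        ∃ τ : ℤ, (τ = 1 ∨ τ = -1) ∧ ∀ y : Site 2, y ax - v ax = σ * ℓ → 0 ≤ τ * (y (oth ax) - v (oth ax)) →
          |y (oth ax) - v (oth ax)| ≤ Wr ℓ → y ∈ Pcore)
    -- the level's kit number, source, support; the region, the target, the weighting, the count
    {Ω : Finset V} (hfull : winLevel G φ w₀ R lo hi j ⊆ Ω)
    (k : ℕ) (o : V) (Sfin : Finset V) {Wt : Sym2 V → unitInterval} {Dr T : Finset V}
    (hWD : IsSubbox (winGraphIn G Ω) Wt q Dr) (hXD : winLevelIn φ Ω lo hi j ⊆ Dr)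
    (hPΩ : Win G φ w₀ Preg R ⊆ Ω) (hPD : Win G φ w₀ Preg R ⊆ Dr) (hPT : Win G φ w₀ Pcore R ⊆ T)
    (hfarT : ∀ x ∈ outerBoundary (winGraph G w₀ R) (winLevel G φ w₀ R lo hi j),
      inNbr G φ w₀ R (Finset.Icc (lo - (j : Site 2)) (hi + (j : Site 2))) x ∉ graphBall G w₀ (R - r₀) →
      inNbr G φ w₀ R (Finset.Icc (lo - (j : Site 2)) (hi + (j : Site 2))) x ∈ T)
    (hpadT : ∀ x ∈ outerBoundary (winGraphIn G Ω) (winLevelIn φ Ω lo hi j),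
      x ∉ outerBoundary (winGraph G w₀ R) (winLevel G φ w₀ R lo hi j) →
      inNbrIn G φ Ω (Finset.Icc (lo - (j : Site 2)) (hi + (j : Site 2))) x ∈ T)
    {N : ℕ} (hN : k * (Δ + 1) ^ (2 * rs) ≤ N)
    (hk : (1 - (q : ℝ) ^ (1 + Δ * ((Δ + 1) ^ R' + (tanOff ℓs M + 2)) + ((Δ + 1) ^ R' + (tanOff ℓs M + 2)) * cU)) ^ k ≤ δ) :
    ∃ (σ : SData V) (S : Finset V), SHyp (winLDataIn G φ Ω lo hi o Sfin) j σ ∧ σ.N ≤ N ∧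
      (1 - (q : ℝ) ^ σ.sB) ^ σ.k ≤ δ ∧ S ⊆ (winLDataIn G φ Ω lo hi o Sfin).X j ∧ S ⊆ Dr ∧
      (∀ x ∈ σ.K, ∀ e ∈ σ.seed x, e ∉ wireSet (↑S : Set V)) ∧ (∀ x ∈ σ.K, σ.face x ⊆ S) ∧
      (∀ x ∈ σ.K, 1 - 3 * δ ≤ (prodBernoulli Wt).real {ω | ∃ u ∈ σ.face x,
        1 - δ < (prodBernoulli (pinW Wt (wireSet (↑S : Set V)) ω)).real (⋃ t ∈ T, openConnIn (↑Dr : Set V) u t)}) := by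
  obtain ⟨hkn, hΛρ⟩ := fatSeqOff_kit_room (G := G) (φ := φ) hfr hC off hkz
  rw [← hD] at hkn hΛρ
  have hcon := kitCon_stepIHab hlip hstep hfr hC hD h hMz hℓK0 hℓK1 hAw hRk hwide hA hK (le_trans (by omega) hr₀₂) hR ax hMℓ hS0 hS1
    hdepth hWr hroom hPΩ hPD hPT hWD hfarT hpadT R'
  exact kitClauseHab' hlip hstep hfr hκ hΔ hδ hℓs hwide hA hAℓ hK D.Λ hkn hΛρ hnA hnM hρK hR'₁ hR'₂ hr₀₁ hr₀₂ hR hrs₁ hrs₂ hcU hfull k o Sfin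
    hWD hXD hN hk hcon

end Skelφ

end Summit.CriticalPhenomena.PercolationContinuityZ3.Theorems.Transplant

end
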